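import Summits.BirchSwinnertonDyer.BirchSwinnertonDyer.Theorems.AdditiveKolyvaginRoadRamifiedHabitatSupply
import HarnessLib

/-!
# Route `AdditiveKolyvaginRoad`, crux KS′ `LevelKolyvaginSystemsAdditive` (item stmt-BirchSwinnertonDyer-21396): THE RAMIFIED HABITAT
# WITH ONE PRESCRIBED INERT PRIME IS NEVER EMPTY — the rank-ONE rows' habitat of crux card `ramified-toric-habitat`
# (sequel of `…RamifiedHabitatSupply.lean`; cell `pub/bsd-wall`, width seat `bsd-wall-akr-p2x-w4` g6; `--supports stmt-BirchSwinnertonDyer-21396`, helper)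

THEOREMS ONLY (no definition, no named fact, no `sorry`).  BSD is not proved by any of this; no sign law is asserted.

THE POINT.  The card `Cruxes/LevelKolyvaginSystemsAdditive/Ideas/ramified-toric-habitat.md` (T3): «sc & `p` ramified & all other bad `q`
split ⟹ sign `+1` (definite habitat = LOW₀ rows); making ONE multiplicative `q₀` INERT flips the sign to `−1` (Shimura curve `X^{p q₀}`,
the LOW₁ rows, which carry ♠(2): two multiplicative primes)».  The prequel proved that the all-split habitat is non-empty
(`RamifiedHabitat.exists_ramifiedHabitat`); this file proves the same for the habitat with one prescribed ODD prime `q₀ ≠ p` inert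
(at a ♯ frame at least one of the two multiplicative primes is odd):

* `exists_imaginaryQuadratic_discr_eq_neg` — for square-free `m > 1` with `8 ∣ m + 1` an imaginary quadratic field `K` (a `Type` with
  `Field ∕ NumberField`) with `d_K = −m`: `K = ℚ[X]/(X² − X + (m+1)/4)` (the construction inside `exists_ramifiedHabitat`, isolated).
* `exists_nat_jacobiSym_eq_neg_one'` — a quadratic non-residue `0 < c < ℓ` modulo an odd prime (as in the tree's
  `CyclotomicIwasawaMainTheoremIrreducibleAuxiliaryFieldsProofs.exists_nat_jacobiSym_eq_neg_one`, re-proved to keep the import cone small).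
* `exists_ramifiedHabitat_inert` — ∀ elliptic `W/ℚ`, ∀ odd prime `p`, ∀ odd prime `q₀ ≠ p`, ∀ `n`: an imaginary quadratic `K` with
  `d_K = −p·q` (`q` prime ∉ {2, p, q₀}`), `d_K` odd, `p ∣ d_K`, `d_K < −n`, `d_K < −4`, `(d_K/q₀) = −1` (INERT) and every bad
  `ℓ ∉ {p, q₀}` split (`(d_K/ℓ) = 1` for odd `ℓ`, `d_K ≡ 1 (mod 8)`).  Chinese remainder (Mathlib `Nat.chineseRemainder`) for
  `q ≡ −p⁻¹ (mod 8N″)` (`N″` = prime-to-`p q₀` part of `N_W`) and `q ≡ c (mod q₀)` with `(−p c/q₀) = −1`, Dirichlet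
  (`Nat.forall_exists_prime_gt_and_modEq`), and the first theorem.

HONEST FRAMING: E-side, unconditional; non-emptiness only.  References (locators only): [cite: Marcus2018, Ch. 2 Thm. 1; Ch. 3 Thm. 25]
[cite: BurungaleCastellaSkinner2025, Lemma 5.2.3 (Dirichlet + CRT pattern)].
-/

-- single-conjunct summit: `Summit.BirchSwinnertonDyer.BirchSwinnertonDyer.…` repeats the name by design
set_option linter.dupNamespace false
set_option autoImplicit false

noncomputable section

open scoped Classical

namespace Summit.BirchSwinnertonDyer.BirchSwinnertonDyer.Theorems.AdditiveKoly.RamifiedHabitat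

open NumberField Polynomial Literature.NumberTheory.EllipticCurves Literature.NumberTheory.QuadraticFields

/-! ## §1 `ℚ(√−m)` for square-free `m ≡ −1 (mod 8)` -/

/-- **An imaginary quadratic field of discriminant `−m`** for every square-free `m > 1` with `8 ∣ m + 1`: `K = ℚ[X]/(X² − X + (m+1)/4)`
(Mathlib `AdjoinRoot`) has `[K : ℚ] = 2`, is totally complex, and `d_K = −m` (§1).  The construction inside `exists_ramifiedHabitat`,
isolated for reuse. [cite: Marcus2018, Ch. 2 Thm. 1] -/
theorem exists_imaginaryQuadratic_discr_eq_neg (m : ℕ) (hm : Squarefree m) (hm1 : 1 < m) (h8 : 8 ∣ m + 1) :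
    ∃ (K : Type) (_ : Field K) (_ : NumberField K), IsImaginaryQuadratic K ∧ NumberField.discr K = -(m : ℤ) := by
  obtain ⟨k, hk⟩ := h8
  have hkZ : (m : ℤ) + 1 = 8 * k := by exact_mod_cast hk
  obtain ⟨f, hf⟩ : ∃ f : ℚ[X],
      f = C 1 * X ^ 2 + C (-((1 : ℤ) : ℚ)) * X + C ((2 * k : ℤ) : ℚ) := ⟨_, rfl⟩
  have hfdeg : f.natDegree = 2 := by rw [hf]; exact natDegree_quadratic one_ne_zero
  have hf0 : f ≠ 0 := by
    intro h; rw [h, natDegree_zero] at hfdeg; exact absurd hfdeg (by norm_num)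
  have hkQ : (m : ℚ) + 1 = 8 * (k : ℚ) := by exact_mod_cast hk
  have hm0 : (0 : ℚ) < (m : ℚ) := by exact_mod_cast (zero_lt_one.trans hm1)
  have hfirr : Irreducible f := by
    refine (irreducible_iff_roots_eq_zero_of_degree_le_three (by omega) (by omega)).mpr ?_
    refine Multiset.eq_zero_of_forall_notMem fun r hr ↦ ?_
    rw [mem_roots hf0, IsRoot.def, eval, hf, eval₂_one_mul_X_sq_add] at hr
    push_cast at hr
    nlinarith [sq_nonneg (2 * r - 1)]
  haveI : Fact (Irreducible f) := ⟨hfirr⟩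
  have hkroot : AdjoinRoot.root f * AdjoinRoot.root f - ((1 : ℤ) : AdjoinRoot f) * AdjoinRoot.root f +
      ((2 * k : ℤ) : AdjoinRoot f) = 0 := by
    rw [← eval₂_one_mul_X_sq_add (AdjoinRoot.of f), ← hf]
    exact AdjoinRoot.eval₂_root f
  have hrel : AdjoinRoot.root f ^ 2 + ((-1 : ℤ) : AdjoinRoot f) * AdjoinRoot.root f +
      ((2 * k : ℤ) : AdjoinRoot f) = 0 := by
    push_cast at hkroot ⊢
    linear_combination hkroot
  have h2 := (AdjoinRoot.powerBasis hf0).finrank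
  rw [AdjoinRoot.powerBasis_dim, hfdeg] at h2
  have h2' : Module.finrank ℚ (AdjoinRoot f) = 2 := by convert h2 using 2
  have hd : (-1 : ℤ) ^ 2 - 4 * (2 * k) = -(m : ℤ) := by linear_combination hkZ
  obtain ⟨htc, hdK⟩ := isTotallyComplex_and_discr_eq_neg_of_root_of_squarefree h2' hm (zero_lt_one.trans hm1) hd hrel
  exact ⟨AdjoinRoot f, inferInstance, inferInstance, ⟨h2', htc⟩, hdK⟩

/-! ## §2 The habitat with one prescribed inert prime -/

/-- A quadratic non-residue modulo an odd prime, as a natural number `0 < c < ℓ` with `(c/ℓ) = −1` (half of the non-zero residues are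
non-squares; Mathlib `FiniteField.exists_nonsquare`). [folklore] -/
theorem exists_nat_jacobiSym_eq_neg_one' {ℓ : ℕ} (hℓ : ℓ.Prime) (hℓ2 : ℓ ≠ 2) :
    ∃ c : ℕ, 0 < c ∧ c < ℓ ∧ jacobiSym c ℓ = -1 := by
  haveI : Fact ℓ.Prime := ⟨hℓ⟩
  have hchar : ringChar (ZMod ℓ) ≠ 2 := by
    rw [ZMod.ringChar_zmod_n]
    exact hℓ2
  obtain ⟨a, ha⟩ := FiniteField.exists_nonsquare hchar
  refine ⟨a.val, ?_, a.val_lt, ?_⟩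
  · rw [Nat.pos_iff_ne_zero]
    intro h0
    apply ha
    rw [ZMod.val_eq_zero] at h0
    rw [h0]
    exact IsSquare.zero
  · rw [← jacobiSym.legendreSym.to_jacobiSym, legendreSym.eq_neg_one_iff]
    simpa using ha

/-- **THE RAMIFIED HABITAT WITH ONE PRESCRIBED INERT PRIME IS NEVER EMPTY** (the rank-one rows' habitat of the card: Shimura curves
`X^{p q₀}`, «making one multiplicative `q₀` inert flips the sign»).  For an elliptic `W/ℚ`, an odd prime `p`, an odd prime `q₀ ≠ p` (in
the application a multiplicative prime of `W`) and any `n`: there is an imaginary quadratic field `K` with `d_K = −p·q` (`q` prime,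
`q ∉ {2, p, q₀}`; so `d_K` odd, `p ∣ d_K`, `d_K < −n`, `d_K < −4`) such that `q₀` is INERT in `K` (`(d_K/q₀) = −1`) and every bad prime
`ℓ ∉ {p, q₀}` of `W` SPLITS (`(d_K/ℓ) = 1` for odd `ℓ`, `d_K ≡ 1 (mod 8)`).  Chinese remainder theorem (Mathlib `Nat.chineseRemainder`)
for the residues `−p⁻¹ (mod 8N″)` (`N″` the prime-to-`p q₀` part of `N_W`) and `c (mod q₀)` with `(−p c / q₀) = −1`, then Dirichlet
(Mathlib `Nat.forall_exists_prime_gt_and_modEq`) and §3. [cite: Marcus2018, Ch. 2 Thm. 1; Ch. 3 Thm. 25]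
[cite: BurungaleCastellaSkinner2025, Lemma 5.2.3 (Dirichlet + CRT pattern)] -/
theorem exists_ramifiedHabitat_inert (W : WeierstrassCurve ℚ) [W.IsElliptic] (p : ℕ) [hp : Fact p.Prime] (hp2 : p ≠ 2)
    (q₀ : ℕ) (hq₀ : q₀.Prime) (hq₀2 : q₀ ≠ 2) (hq₀p : q₀ ≠ p) (n : ℕ) :
    ∃ (K : Type) (_ : Field K) (_ : NumberField K),
      IsImaginaryQuadratic K ∧
      (∃ q : ℕ, q.Prime ∧ q ≠ 2 ∧ q ≠ p ∧ q ≠ q₀ ∧ NumberField.discr K = -((p * q : ℕ) : ℤ)) ∧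
      Odd (NumberField.discr K) ∧ (p : ℤ) ∣ NumberField.discr K ∧
      NumberField.discr K < -(n : ℤ) ∧ NumberField.discr K < -4 ∧
      jacobiSym (NumberField.discr K) q₀ = -1 ∧
      ∀ q : ℕ, q.Prime → (q : ℤ) ∣ (W.conductorNorm ℤ : ℤ) → q ≠ p → q ≠ q₀ →
        (q ≠ 2 → jacobiSym (NumberField.discr K) q = 1) ∧ (q = 2 → NumberField.discr K % 8 = 1) := by
  have hpP : p.Prime := hp.out
  -- the prime-to-`p q₀` part `N″` of the conductor and the modulus `A = 8 N″`
  set N : ℕ := W.conductorNorm ℤ with hN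
  have hN0 : N ≠ 0 := (W.conductorNorm_pos_holds).ne'
  set N' : ℕ := N / p ^ N.factorization p with hN'
  have hN'0 : N' ≠ 0 := (Nat.ordCompl_pos p hN0).ne'
  set N'' : ℕ := N' / q₀ ^ N'.factorization q₀ with hN''
  have hN''0 : N'' ≠ 0 := (Nat.ordCompl_pos q₀ hN'0).ne'
  have hcopN' : Nat.Coprime p N' := Nat.coprime_ordCompl hpP hN0
  have hcopN'' : Nat.Coprime p N'' := Nat.Coprime.coprime_dvd_right (Nat.ordCompl_dvd N' q₀) hcopN'
  have hcopq₀N'' : Nat.Coprime q₀ N'' := Nat.coprime_ordCompl hq₀ hN'0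
  have hcop8 : Nat.Coprime p 8 := by
    have : Nat.Coprime p 2 := (Nat.coprime_primes hpP Nat.prime_two).mpr hp2
    simpa using this.pow_right 3
  have hcop8q₀ : Nat.Coprime q₀ 8 := by
    have : Nat.Coprime q₀ 2 := (Nat.coprime_primes hq₀ Nat.prime_two).mpr hq₀2
    simpa using this.pow_right 3
  set A : ℕ := 8 * N'' with hA
  have hA0 : A ≠ 0 := mul_ne_zero (by norm_num) hN''0
  haveI : NeZero A := ⟨hA0⟩
  have hcopA : Nat.Coprime p A := Nat.Coprime.mul_right hcop8 hcopN''
  have hcopAq₀ : Nat.Coprime A q₀ := (Nat.Coprime.mul_right hcop8q₀ hcopq₀N'').symm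
  -- the residue `a₁ ≡ -p⁻¹ (mod A)`
  set up : (ZMod A)ˣ := ZMod.unitOfCoprime p hcopA with hup
  set a₁ : ℕ := ((-((up⁻¹ : (ZMod A)ˣ) : ZMod A)) : ZMod A).val with ha₁
  have ha₁A : (a₁ : ZMod A) = -((up⁻¹ : (ZMod A)ˣ) : ZMod A) := by rw [ha₁, ZMod.natCast_zmod_val]
  have hcopa₁ : Nat.Coprime a₁ A := by
    rw [← ZMod.isUnit_iff_coprime, ha₁A]
    exact (Units.isUnit _).neg
  -- the residue `c (mod q₀)` with `(-p c / q₀) = -1`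
  have hgcd : Int.gcd (-(p : ℤ)) q₀ = 1 := by
    rw [Int.neg_gcd, Int.gcd_natCast_natCast]
    exact (Nat.coprime_primes hpP hq₀).mpr (Ne.symm hq₀p)
  have hs : jacobiSym (-(p : ℤ)) q₀ = 1 ∨ jacobiSym (-(p : ℤ)) q₀ = -1 := jacobiSym.eq_one_or_neg_one hgcd
  obtain ⟨c, hc0, hcq₀, hc⟩ : ∃ c : ℕ, 0 < c ∧ c < q₀ ∧ jacobiSym (-(p : ℤ)) q₀ * jacobiSym c q₀ = -1 := by
    rcases hs with hs | hs
    · obtain ⟨c, hc0, hclt, hc⟩ := exists_nat_jacobiSym_eq_neg_one' hq₀ hq₀2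
      exact ⟨c, hc0, hclt, by rw [hs, hc]; norm_num⟩
    · exact ⟨1, one_pos, hq₀.one_lt, by rw [hs, Nat.cast_one, jacobiSym.one_left]; norm_num⟩
  have hcopc : Nat.Coprime c q₀ :=
    Nat.coprime_comm.mp ((Nat.Prime.coprime_iff_not_dvd hq₀).mpr (Nat.not_dvd_of_pos_of_lt hc0 hcq₀))
  -- Chinese remainder + Dirichlet: a prime `q ≡ a₁ (mod A)`, `q ≡ c (mod q₀)`, above `max n (max p q₀)`
  obtain ⟨k, hkA, hkq₀⟩ := Nat.chineseRemainder hcopAq₀ a₁ c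
  have hcopk : Nat.Coprime k (A * q₀) := by
    refine Nat.Coprime.mul_right ?_ ?_
    · unfold Nat.Coprime at hcopa₁ ⊢
      rw [hkA.gcd_eq]; exact hcopa₁
    · unfold Nat.Coprime at hcopc ⊢
      rw [hkq₀.gcd_eq]; exact hcopc
  obtain ⟨q, hqn, hq, hqmod⟩ :=
    Nat.forall_exists_prime_gt_and_modEq (max n (max p q₀)) (mul_ne_zero hA0 hq₀.ne_zero) hcopk
  have hqn' : n < q := lt_of_le_of_lt (le_max_left _ _) hqn
  have hqp' : p < q := lt_of_le_of_lt ((le_max_left _ _).trans (le_max_right _ _)) hqn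
  have hqq₀' : q₀ < q := lt_of_le_of_lt ((le_max_right _ _).trans (le_max_right _ _)) hqn
  have hqp : q ≠ p := hqp'.ne'
  have hqq₀ : q ≠ q₀ := hqq₀'.ne'
  have hqa₁ : q ≡ a₁ [MOD A] := (hqmod.of_mul_right q₀).trans hkA
  have hqc : q ≡ c [MOD q₀] := (hqmod.of_mul_left A).trans hkq₀
  -- `A ∣ p q + 1`
  have hdvd : A ∣ p * q + 1 := by
    rw [← ZMod.natCast_eq_zero_iff]
    push_cast
    rw [(ZMod.natCast_eq_natCast_iff _ _ _).mpr hqa₁, ha₁A, ← ZMod.coe_unitOfCoprime p hcopA, ← hup, mul_neg, Units.mul_inv,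
      neg_add_cancel]
  obtain ⟨k', hk'⟩ := hdvd
  have h8 : 8 ∣ p * q + 1 := (dvd_mul_right 8 N'').trans ⟨k', hk'⟩
  have hq2 : q ≠ 2 := by
    rintro rfl
    have : 2 ∣ p * 2 + 1 := (dvd_mul_right 2 4).trans h8
    omega
  -- the field
  have hsqf : Squarefree (p * q) :=
    (Nat.squarefree_mul ((Nat.coprime_primes hpP hq).mpr hqp.symm)).mpr ⟨hpP.squarefree, hq.squarefree⟩
  have h1m : 1 < p * q := one_lt_mul'' hpP.one_lt hq.one_lt
  obtain ⟨K, iF, iN, hK, hdK⟩ := exists_imaginaryQuadratic_discr_eq_neg (p * q) hsqf h1m h8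
  have hkZ : ((p * q : ℕ) : ℤ) + 1 = 8 * N'' * k' := by exact_mod_cast hk'
  refine ⟨K, iF, iN, hK, ⟨q, hq, hq2, hqp, hqq₀, hdK⟩, ?_, ?_, ?_, ?_, ?_, ?_⟩
  · -- odd
    rw [hdK]
    have : Odd ((p * q : ℕ) : ℤ) := by exact_mod_cast (hpP.odd_of_ne_two hp2).mul (hq.odd_of_ne_two hq2)
    exact this.neg
  · -- `p ∣ d_K`
    rw [hdK]
    exact Dvd.dvd.neg_right ⟨q, by push_cast; ring⟩
  · -- `d_K < -n`
    rw [hdK]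
    have : n < p * q := lt_of_lt_of_le hqn' (Nat.le_mul_of_pos_left q hpP.pos)
    omega
  · -- `d_K < -4`
    rw [hdK]
    have h3 : 3 ≤ p := by
      have := hpP.two_le
      omega
    have : 4 < p * q := by nlinarith [hpP.two_le]
    omega
  · -- `q₀` inert: `(d_K / q₀) = (-p/q₀) (q/q₀) = (-p/q₀) (c/q₀) = -1`
    rw [hdK, show (-((p * q : ℕ) : ℤ)) = (-(p : ℤ)) * (q : ℤ) by push_cast; ring, jacobiSym.mul_left]
    have hqc' : jacobiSym (q : ℤ) q₀ = jacobiSym (c : ℤ) q₀ := by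
      rw [jacobiSym.mod_left (q : ℤ), jacobiSym.mod_left (c : ℤ), ← Int.natCast_mod, ← Int.natCast_mod, hqc]
    rw [hqc']
    exact hc
  · -- the other bad primes split
    intro ℓ hℓ hℓN hℓp hℓq₀
    have hℓN_nat : ℓ ∣ N := by rw [hN]; exact Int.natCast_dvd_natCast.mp hℓN
    have hℓN' : ℓ ∣ N' := by
      have h := Nat.ordCompl_dvd_ordCompl_of_dvd hℓN_nat p
      have hℓfac : ℓ.factorization p = 0 :=
        Nat.factorization_eq_zero_of_not_dvd fun hpl ↦ hℓp ((Nat.prime_dvd_prime_iff_eq hpP hℓ).mp hpl).symm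
      rw [hℓfac, pow_zero, Nat.div_one] at h
      exact h
    have hℓN'' : ℓ ∣ N'' := by
      have h := Nat.ordCompl_dvd_ordCompl_of_dvd hℓN' q₀
      have hℓfac : ℓ.factorization q₀ = 0 :=
        Nat.factorization_eq_zero_of_not_dvd fun hql ↦ hℓq₀ ((Nat.prime_dvd_prime_iff_eq hq₀ hℓ).mp hql).symm
      rw [hℓfac, pow_zero, Nat.div_one] at h
      exact h
    have hℓdvd : (ℓ : ℤ) ∣ ((p * q : ℕ) : ℤ) + 1 := by
      rw [hkZ]
      exact (Int.natCast_dvd_natCast.mpr hℓN'').trans ⟨8 * k', by ring⟩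
    refine ⟨fun hℓ2 ↦ ?_, fun hℓ2 ↦ ?_⟩
    · rw [hdK]
      have hmod : (-((p * q : ℕ) : ℤ)) % (ℓ : ℤ) = (1 : ℤ) % (ℓ : ℤ) := by
        have : (-((p * q : ℕ) : ℤ)) ≡ 1 [ZMOD (ℓ : ℤ)] := by
          rw [Int.modEq_iff_dvd]
          simpa [sub_neg_eq_add, add_comm] using hℓdvd
        exact this
      rw [jacobiSym.mod_left, hmod, ← jacobiSym.mod_left, jacobiSym.one_left]
    · rw [hdK]
      have h8' : (8 : ℤ) ∣ ((p * q : ℕ) : ℤ) + 1 := by rw [hkZ]; exact ⟨N'' * k', by ring⟩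
      omega

end Summit.BirchSwinnertonDyer.BirchSwinnertonDyer.Theorems.AdditiveKoly.RamifiedHabitat

end
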